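import Mathlib
import HarnessLib
import Summits.Ventures.LatticeQCDFlow.Exactness.SUNJitteredHMCExactStep

/-!
# A box minorant for the engine's leapfrog HMC that is UNIFORM over an interval of step sizes — the instance behind the atomless `tau_jitter` law

HONEST FRAMING: exact (Metropolis-corrected) sampling algorithms for lattice gauge theory;
figures of merit are autocorrelation/cost numbers at stated couplings and volumes; no
continuum-physics claim.

Venture `LatticeQCDFlow` (cell pub-lqcd), topic `Exactness`, FANOUT row 9 (eng-latcore, GEN-24; the engine's
`latflow.core.hmc.HMC.trajectory(rng, τ, nstep, tau_jitter = j)`: the trajectory LENGTH is drawn as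
`τ(1 + j(2u − 1))`, `u ∼ U(0,1)`, i.e. UNIFORMLY on `[τ(1−j), τ(1+j)]`, `nstep` fixed, so the STEP SIZE
`τ'/nstep` ranges over an interval).  NEW WORK of the cell over the tree (gen-18's
`SUNMultiStepLeapfrogHMCErgodic.lean` — the walk minorant `sunLeapfrogHMCN_minorised_walk`, whose constant is
existential PER step size; `SUNMultiStepPositionLaw.lean`: `chartKickR`, `smul_chartKickR_eq`,
`sunLeapfrogProposalN_position_law`; `SUNMultiStepThreshold.sunShortTraj_package`;
`SUNLeapfrogHMCWalk.refreshUpdate_involMH_minorised_at`; `KickLawsNearIdentity.exists_smul_haar_restrict_le_chartKickR`;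
`HaarBoxMinorants.smul_restrict_box_le_mulWalk_pi`; `SUNMultiStepLeapfrogHMCEngine.trajLength_threshold_arith`;
`SUNJitteredHMCExactStep.lean` for the per-step form it generalises).  Nothing is cited as a fact; no number is
claimed.

WHY.  GEN-22/23 typed the jittered HMC update through an ATOM of the jitter law (`JitteredHMC.lean`,
`SUNJitteredHMCCertificates.lean`); GEN-23's `JitteredHMCCommonMinorant.lean` reduced the ATOMLESS case to ONE
statewise minorant shared by the frozen-step updates over a label set of positive mass, and recorded the missing
INSTANCE: "a common minorant for the engine's leapfrog kernels over an interval of step sizes (it needs the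
constants of gen-15/18's chart minorisation uniform in the step, not extracted)".  This file extracts them.

THE TWO OBSERVATIONS.  (i) The chart kick of radius `r` — the normalised image of Lebesgue measure on the ball
`B(0, r)` under the exponential chart — DOMINATES `(μB(0,r₁)/μB(0,r₂)) ·` the chart kick of radius `r₁` for every
`r ∈ [r₁, r₂]` (a bigger ball carries the smaller one; only the normalisation shrinks): `smul_chartKickR_le_chartKickR`.
(ii) In gen-18's walk minorant `K_ε(U,·) ≥ δ(ε) · ((⊗ chartKickR (nε/3)) · U)` the constant is
`δ(ε) = e^{−B} · c_box · ((A·4nε/3)^{−dim} μ(B(0,nε/3))^{|links|})` with `B`, `c_box`, `A` free of `ε` once the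
momentum increment is bounded and Lipschitz UNIFORMLY on the interval — so `δ(ε) ≥ δ(ε₁, ε₂) > 0` on `[ε₁, ε₂]`.

## Content (setting of `SUNMultiStepLeapfrogHMCErgodic.lean`: coordinates `ι` onto `𝔰𝔲(N)`, Haar `μ` on `E`,
kinetic term `T`, `n ≥ 1` steps, action `S` bounded by `s`; a FAMILY of increments `g_ε`, `ε ∈ [ε₁, ε₂]`,
`0 < ε₁ ≤ ε₂`, bounded by `b` and `K_g`-Lipschitz uniformly; thresholds at `ε₂`)

* §1 **`smul_chartKickR_le_chartKickR`**, **`smul_mulWalk_pi_chartKickR_le`** — observation (i), one link and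
  all links.
* §2 **`sunLeapfrogHMCN_minorised_walk_uniform`** — ONE `δ > 0` with
  `δ · ((⊗ chartKickR (nε₁/3)) · U) ≤ K_ε(U, ·)` for EVERY `ε ∈ [ε₁, ε₂]` and EVERY `U`.
* §3 **`engine_sunLeapfrogHMCN_box_minorised_uniform`** — the engine's coordinates / kinetic term / Gaussian
  refresh: ONE open `V ∋ 1` and ONE `κ ≠ 0` with `κ · Haar^{⊗links}|_{box_V(U)} ≤ K_ε(U, ·)` for every
  `ε ∈ [ε₁, ε₂]`, every `U`.
* §4 **`engine_sunLeapfrogHMCN_box_minorised_uniform_of_trajLength`** — trajectory-length form with THE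
  ENGINE'S half kick `−(ε/2)·F` (measurable `F` bounded by `F_max`, `K_F`-Lipschitz): there is `τ₀ > 0` such
  that for EVERY `nstep ≥ 1` and EVERY `0 < τ₁ ≤ τ₂ ≤ τ₀`, ONE `(V, κ)` serves every trajectory length
  `τ' ∈ [τ₁, τ₂]` (step `τ'/nstep`) and every `U` — the common minorant `JitteredHMCCommonMinorant.lean` asks for.

NOT CLAIMED: any value of the constants; anything at or beyond the threshold; OMF words; floating point.  The
jittered kernel with a general (atomless) label law and its convergence are the next files
(`SUNJitteredHMCMeasurableLabels.lean`, `SUNJitteredHMCAtomless.lean`).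
-/

noncomputable section

namespace Summit.Ventures.LatticeQCDFlow.Exactness

open MeasureTheory ProbabilityTheory ProbabilityTheory.Kernel Set Metric Function NormedSpace Filter Topology
open Literature.MathematicalPhysics.QuantumFieldTheory (haarProbability)
open scoped ENNReal Matrix Matrix.Norms.Operator NNReal

set_option backward.isDefEq.respectTransparency false

section SUN

variable {n : Type*} [Fintype n] [DecidableEq n] [Nonempty n]
variable {E : Type*} [NormedAddCommGroup E] [NormedSpace ℝ E] [MeasurableSpace E] [BorelSpace E]
  [FiniteDimensional ℝ E]
variable (ι : E →ₗ[ℝ] Matrix n n ℂ) (hι : ∀ a, (ι a)ᴴ = -ι a ∧ (ι a).trace = 0) (hinj : Injective ι)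
variable {L : Type*} [Fintype L] (μ : Measure E) [μ.IsAddHaarMeasure]
variable {T : (L → E) → ℝ} {τ : ℝ → ℝ}

/-! ## §1 The chart kick of radius `r ∈ [r₁, r₂]` dominates a fixed multiple of the chart kick of radius `r₁` -/

omit [Nonempty n] hinj in
/-- **OBSERVATION (i)**: `(μB(0,r₂))⁻¹ μB(0,r₁) • chartKickR r₁ ≤ chartKickR r` for `0 < r₁ ≤ r ≤ r₂`. -/
theorem smul_chartKickR_le_chartKickR {r₁ r r₂ : ℝ} (hr₁ : 0 < r₁) (h₁ : r₁ ≤ r) (h₂ : r ≤ r₂) :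
    ((μ (ball (0 : E) r₂))⁻¹ * μ (ball (0 : E) r₁)) • chartKickR ι hι μ r₁ ≤ chartKickR ι hι μ r := by
  rw [mul_smul, smul_chartKickR_eq ι hι μ hr₁, chartKickR]
  refine Measure.le_iff.2 fun A hA => ?_
  have hpre : MeasurableSet (suExp ι hι ⁻¹' A) := (continuous_suExp ι hι).measurable hA
  rw [Measure.smul_apply, smul_eq_mul, Measure.map_apply (continuous_suExp ι hι).measurable hA,
    Measure.restrict_apply hpre, Measure.smul_apply, smul_eq_mul,
    Measure.map_apply (continuous_suExp ι hι).measurable hA, Measure.restrict_apply hpre]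
  exact mul_le_mul' (ENNReal.inv_le_inv.2 (measure_mono (ball_subset_ball h₂)))
    (measure_mono (inter_subset_inter_right _ (ball_subset_ball h₁)))

omit [Nonempty n] hinj in
/-- **… on all links, from every base**: `((μB(0,r₂))⁻¹ μB(0,r₁))^{|links|} • ((⊗ chartKickR r₁) · U) ≤
(⊗ chartKickR r) · U` for `0 < r₁ ≤ r ≤ r₂`. -/
theorem smul_mulWalk_pi_chartKickR_le {r₁ r r₂ : ℝ} (hr₁ : 0 < r₁) (h₁ : r₁ ≤ r) (h₂ : r ≤ r₂)
    (U : L → Matrix.specialUnitaryGroup n ℂ) :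
    ((μ (ball (0 : E) r₂))⁻¹ * μ (ball (0 : E) r₁)) ^ Fintype.card L •
        mulWalk (Measure.pi fun _ : L => chartKickR ι hι μ r₁) U ≤
      mulWalk (Measure.pi fun _ : L => chartKickR ι hι μ r) U := by
  classical
  haveI := isProbabilityMeasure_chartKickR ι hι μ hr₁
  haveI := isProbabilityMeasure_chartKickR ι hι μ (hr₁.trans_le h₁)
  have h := smul_pi_le_pi (c := fun _ : L => (μ (ball (0 : E) r₂))⁻¹ * μ (ball (0 : E) r₁))
    fun _ : L => smul_chartKickR_le_chartKickR ι hι μ hr₁ h₁ h₂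
  rw [Finset.prod_const, Finset.card_univ] at h
  exact smul_mulWalk_le h U

/-! ## §2 The walk minorant with ONE constant for every step size in `[ε₁, ε₂]` -/

variable {g : ℝ → (L → Matrix.specialUnitaryGroup n ℂ) → L → E}

/-- **OBSERVATION (ii): `K_ε(U, ·) ≥ δ · ((⊗ chartKickR (nε₁/3)) · U)` WITH ONE `δ > 0` FOR EVERY `ε ∈ [ε₁, ε₂]` AND
EVERY `U`.**  Setting of `sunLeapfrogHMCN_minorised_walk` with a FAMILY of increments `g_ε` (each measurable)
bounded by `b ≥ 0` per link and `K_g`-Lipschitz (`K_g ≥ 0`) in the matrix sup norm UNIFORMLY on `[ε₁, ε₂]`,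
`0 < ε₁ ≤ ε₂`, and the short-trajectory thresholds at `ε₂`: `nε₂, (2n+1)b, K_g ε₂ n² ≤ s(ι)`. -/
theorem sunLeapfrogHMCN_minorised_walk_uniform
    (hsurj : ∀ X : Matrix n n ℂ, Xᴴ = -X → X.trace = 0 → X ∈ LinearMap.range ι)
    {ε₁ ε₂ : ℝ} (hε₁ : 0 < ε₁) (h12 : ε₁ ≤ ε₂) {N : ℕ} (hN : 1 ≤ N) (hT : Measurable T) (hT0 : ∀ p, 0 ≤ T p)
    (hTle : ∀ (R : ℝ) (p : L → E), (∀ l, ‖p l‖ ≤ R) → T p ≤ τ R) (hZ : sunMomentumWeight (L := L) μ T univ ≠ ⊤)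
    (hg : ∀ ε, Measurable (g ε)) {b Kg : ℝ} (hb0 : 0 ≤ b) (hb : ∀ ε ∈ Icc ε₁ ε₂, ∀ u l, ‖g ε u l‖ ≤ b)
    (hK0 : 0 ≤ Kg) (hK : ∀ ε ∈ Icc ε₁ ε₂, ∀ U U', ‖g ε U - g ε U'‖ ≤ Kg * ‖coeConfig U - coeConfig U'‖)
    {S : (L → Matrix.specialUnitaryGroup n ℂ) → ℝ} (hS : Measurable S) {s : ℝ} (hs : ∀ u, |S u| ≤ s)
    (h1 : N * ε₂ ≤ sunShortTrajThreshold ι hinj) (h2 : (2 * N + 1) * b ≤ sunShortTrajThreshold ι hinj)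
    (h3 : Kg * ε₂ * (N : ℝ) ^ 2 ≤ sunShortTrajThreshold ι hinj) :
    ∃ δ : ℝ≥0∞, 0 < δ ∧ ∀ ε ∈ Icc ε₁ ε₂, ∀ u,
      δ • mulWalk (Measure.pi fun _ : L => chartKickR ι hι μ (N * ε₁ / 3)) u ≤
        sunLeapfrogHMCN ι hι ε μ T (hg ε) S N u := by
  classical
  have hρ := sunExpRadius_spec (n := n) ι hinj
  have hρL := sunLogRadius_spec (n := n) ι hinj
  have hdefL := linkExp_defect_of_matrix (L := L) (sunExpDefect_pos ι hinj).le hρ.2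
  have hlogL := linkLog_defect_of_matrix (L := L) (sunLogDefect_pos ι hinj).le hρL.2.1
  -- the Lipschitz image constant of `μ^{⊗links}` (free of `ε`), made positive
  obtain ⟨A, hA⟩ := exists_addHaar_image_le_of_lipschitzOnWith (Measure.pi fun _ : L => μ)
  have hA' : ∀ (K' : ℝ≥0) (f : (L → E) → L → E) (s' : Set (L → E)), LipschitzOnWith K' f s' →
      Measure.pi (fun _ : L => μ) (f '' s') ≤ (((A + 1) * K' : ℝ≥0) : ℝ≥0∞) ^ Module.finrank ℝ (L → E) *
        Measure.pi (fun _ : L => μ) s' := fun K' f s' hf =>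
    (hA K' f s' hf).trans (by gcongr; exact le_self_add)
  -- constants, all free of `ε`
  set cbox : ℝ≥0∞ := (sunMomentumWeight (L := L) μ T univ)⁻¹ * ENNReal.ofReal (Real.exp (-τ 2)) with hcbox
  set B : ℝ := 2 * s + τ (1 + 2 * ((N : ℝ) + 1) * b) with hB
  set cpos : ℝ≥0∞ := (((((A + 1) * Real.toNNReal (N * ε₂ + N * ε₂ / 3) : ℝ≥0) : ℝ≥0∞) ^ Module.finrank ℝ (L → E))⁻¹ *
      μ (ball (0 : E) (N * ε₁ / 3)) ^ Fintype.card L) with hcpos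
  set cL : ℝ≥0∞ := ((μ (ball (0 : E) (N * ε₂ / 3)))⁻¹ * μ (ball (0 : E) (N * ε₁ / 3))) ^ Fintype.card L with hcL
  have hH : Measurable fun z : (L → Matrix.specialUnitaryGroup n ℂ) × (L → E) => S z.1 + T z.2 :=
    (hS.comp measurable_fst).add (hT.comp measurable_snd)
  have hs0 : 0 ≤ s := (abs_nonneg _).trans (hs fun _ => 1)
  have hτ0 : 0 ≤ τ (1 + 2 * ((N : ℝ) + 1) * b) :=
    (hT0 0).trans (hTle _ 0 fun l => by simp only [Pi.zero_apply, norm_zero]; positivity)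
  have hB0 : 0 ≤ B := by positivity
  have hcbox0 : cbox ≠ 0 := mul_ne_zero (ENNReal.inv_ne_zero.2 hZ) (ENNReal.ofReal_pos.2 (Real.exp_pos _)).ne'
  have hN0 : (0 : ℝ) < N := Nat.cast_pos.2 hN
  have hε₂ : 0 < ε₂ := hε₁.trans_le h12
  have hr₁ : 0 < (N : ℝ) * ε₁ / 3 := by positivity
  have hr₂ : 0 < (N : ℝ) * ε₂ / 3 := by positivity
  have hcpos0 : cpos ≠ 0 := mul_ne_zero (ENNReal.inv_ne_zero.2 (ENNReal.pow_ne_top ENNReal.coe_ne_top))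
    (pow_ne_zero _ (measure_ball_pos μ _ hr₁).ne')
  have hcL0 : cL ≠ 0 :=
    pow_ne_zero _ (mul_ne_zero (ENNReal.inv_ne_zero.2 measure_ball_lt_top.ne) (measure_ball_pos μ _ hr₁).ne')
  refine ⟨ENNReal.ofReal (Real.exp (-B)) * (cbox * cpos) * cL, ?_, fun ε hε u => ?_⟩
  · exact pos_iff_ne_zero.2 (mul_ne_zero (mul_ne_zero (ENNReal.ofReal_pos.2 (Real.exp_pos _)).ne'
      (mul_ne_zero hcbox0 hcpos0)) hcL0)
  -- the step `ε ∈ [ε₁, ε₂]`: thresholds and the standing hypotheses at base `u`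
  have hε0 : 0 < ε := hε₁.trans_le hε.1
  have hr : 0 < (N : ℝ) * ε / 3 := by positivity
  have h1ε : N * ε ≤ sunShortTrajThreshold ι hinj := (mul_le_mul_of_nonneg_left hε.2 hN0.le).trans h1
  have h3ε : Kg * ε * (N : ℝ) ^ 2 ≤ sunShortTrajThreshold ι hinj :=
    (mul_le_mul_of_nonneg_right (mul_le_mul_of_nonneg_left hε.2 hK0) (sq_nonneg _)).trans h3
  obtain ⟨hT1, hT2a, hT2b, hT3, hT4⟩ := sunShortTraj_package ι hinj (L := L) hN hε0 hb0 hK0 h1ε h2 h3ε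
  have hPLF := plfBounds_sun ι hι (u := u) (g := g ε) hb0 (hb ε hε) hK0 (hK ε hε) hρ.1 (sunExpDefect_pos ι hinj)
    (sunExpDefect_le_one ι hinj) hdefL
  have hΦ : Measurable fun p : L → E => (sunLeapfrogProposalN ι hι ε (g ε) N (u, p)).1 :=
    measurable_fst.comp ((measurable_sunLeapfrogProposalN ι hι ε N (hg ε)).comp measurable_prodMk_left)
  -- gen-18's minorant at THIS `ε`, with its `ε`-dependent constant written out
  set cposε : ℝ≥0∞ := (((((A + 1) * Real.toNNReal (N * ε + N * ε / 3) : ℝ≥0) : ℝ≥0∞) ^ Module.finrank ℝ (L → E))⁻¹ *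
      μ (ball (0 : E) (N * ε / 3)) ^ Fintype.card L) with hcposε
  have key : (ENNReal.ofReal (Real.exp (-B)) * (cbox * cposε)) •
      mulWalk (Measure.pi fun _ : L => chartKickR ι hι μ (N * ε / 3)) u ≤ sunLeapfrogHMCN ι hι ε μ T (hg ε) S N u := by
    refine refreshUpdate_involMH_minorised_at (measurable_sunLeapfrogProposalN ι hι ε N (hg ε)) hH (sunMomentumLaw μ T)
      (ρ := cbox • (Measure.pi fun _ : L => μ).restrict (closedBall (0 : L → E) 1)) ?_ u ?_ ?_
    · exact (measure_smul_le_smul_of_le (Measure.restrict_mono closedBall_subset_sunMomBox le_rfl) cbox).trans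
        (smul_restrict_sunMomBox_le_sunMomentumLaw μ T τ hTle 2)
    · exact Measure.ae_smul_measure ((ae_restrict_iff' measurableSet_closedBall).2
        (Filter.Eventually.of_forall fun p hp => le_involAcceptE_of_le hB0
          (sunLeapfrogN_energy_window ι hι hPLF hT0 hTle hs (mem_closedBall_zero_iff.1 hp) N))) _
    · refine Measure.le_iff.2 fun A' hA'm => ?_
      have hlaw := sunLeapfrogProposalN_position_law ι hι hinj μ hsurj hPLF hε0 hN hT1 hT2a hT2b
        (sunLogDefect_pos ι hinj).le (sunLogDefect_le_one ι hinj) hlogL hρL.2.2 hT3 hT4 (A := A + 1) (by simp) hA' hA'm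
      rw [Measure.smul_apply, smul_eq_mul, Measure.map_apply hΦ hA'm, Measure.smul_apply, smul_eq_mul,
        Measure.restrict_apply (hΦ hA'm), mul_assoc]
      exact mul_le_mul' le_rfl hlaw
  -- `cpos ≤ cposε` on `[ε₁, ε₂]`
  have hcp : cpos ≤ cposε := by
    refine mul_le_mul' (ENNReal.inv_le_inv.2 ?_) ?_
    · have hle : Real.toNNReal (N * ε + N * ε / 3) ≤ Real.toNNReal (N * ε₂ + N * ε₂ / 3) :=
        Real.toNNReal_le_toNNReal (by nlinarith [hε.2, hN0])
      gcongr
    · exact pow_le_pow_left' (measure_mono (ball_subset_ball (by nlinarith [hε.1, hN0]))) _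
  -- assemble: `δ • W u ≤ δ(ε)·((⊗ chartKickR (nε/3))·u) ≤ K_ε u`
  calc (ENNReal.ofReal (Real.exp (-B)) * (cbox * cpos) * cL) •
          mulWalk (Measure.pi fun _ : L => chartKickR ι hι μ (N * ε₁ / 3)) u
      = (ENNReal.ofReal (Real.exp (-B)) * (cbox * cpos)) •
          (cL • mulWalk (Measure.pi fun _ : L => chartKickR ι hι μ (N * ε₁ / 3)) u) := by rw [smul_smul]
    _ ≤ (ENNReal.ofReal (Real.exp (-B)) * (cbox * cpos)) •
          mulWalk (Measure.pi fun _ : L => chartKickR ι hι μ (N * ε / 3)) u :=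
        measure_smul_le_smul_of_le (smul_mulWalk_pi_chartKickR_le ι hι μ hr₁ (by nlinarith [hε.1, hN0])
          (by nlinarith [hε.2, hN0]) u) _
    _ ≤ (ENNReal.ofReal (Real.exp (-B)) * (cbox * cposε)) •
          mulWalk (Measure.pi fun _ : L => chartKickR ι hι μ (N * ε / 3)) u := by
        refine Measure.le_iff'.2 fun A' => ?_
        simp only [Measure.smul_apply, smul_eq_mul]
        exact mul_le_mul' (mul_le_mul' le_rfl (mul_le_mul' le_rfl hcp)) le_rfl
    _ ≤ _ := key

end SUN

/-! ## §3 The engine's coordinates: ONE box minorant for every step size in `[ε₁, ε₂]` -/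

section Box

variable (N : ℕ) [NeZero N] {L : Type*} [Fintype L] {ε₁ ε₂ : ℝ} {nstep : ℕ}
  {g : ℝ → (L → Matrix.specialUnitaryGroup (Fin N) ℂ) → L → SUNCoords N}
  {S : (L → Matrix.specialUnitaryGroup (Fin N) ℂ) → ℝ} {b Kg s : ℝ}

/-- **THE ENGINE'S `n`-STEP LEAPFROG HMC UPDATE DOMINATES PRODUCT HAAR ON A BOX AROUND EVERY CONFIGURATION, WITH
ONE BOX AND ONE CONSTANT FOR EVERY STEP SIZE `ε ∈ [ε₁, ε₂]`** (hypotheses of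
`sunLeapfrogHMCN_minorised_walk_uniform` in the engine's coordinates `sunCoordι N`, kinetic term `sunKinetic N`,
Gaussian refresh): there are an open `V ∋ 1` and `κ ≠ 0` with `κ · Haar^{⊗links}|_{ {W : ∀ j, W_j U_j⁻¹ ∈ V} } ≤ K_ε(U, ·)`
for EVERY `ε ∈ [ε₁, ε₂]` and EVERY `U`. -/
theorem engine_sunLeapfrogHMCN_box_minorised_uniform (hε₁ : 0 < ε₁) (h12 : ε₁ ≤ ε₂) (hn : 1 ≤ nstep)
    (hg : ∀ ε, Measurable (g ε)) (hb0 : 0 ≤ b) (hb : ∀ ε ∈ Icc ε₁ ε₂, ∀ u l, ‖g ε u l‖ ≤ b) (hK0 : 0 ≤ Kg)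
    (hK : ∀ ε ∈ Icc ε₁ ε₂, ∀ U U', ‖g ε U - g ε U'‖ ≤ Kg * ‖coeConfig U - coeConfig U'‖) (hS : Measurable S)
    (hs : ∀ u, |S u| ≤ s)
    (h1 : nstep * ε₂ ≤ sunShortTrajThreshold (sunCoordι N) (sunCoordι_injective N))
    (h2 : (2 * nstep + 1) * b ≤ sunShortTrajThreshold (sunCoordι N) (sunCoordι_injective N))
    (h3 : Kg * ε₂ * (nstep : ℝ) ^ 2 ≤ sunShortTrajThreshold (sunCoordι N) (sunCoordι_injective N)) :
    ∃ V : Set (Matrix.specialUnitaryGroup (Fin N) ℂ), IsOpen V ∧ (1 : Matrix.specialUnitaryGroup (Fin N) ℂ) ∈ V ∧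
      ∃ κ : ℝ≥0∞, κ ≠ 0 ∧ ∀ ε ∈ Icc ε₁ ε₂, ∀ U : L → Matrix.specialUnitaryGroup (Fin N) ℂ,
        κ • (Measure.pi fun _ : L => haarProbability (Matrix.specialUnitaryGroup (Fin N) ℂ)).restrict
            {W | ∀ j, W j * (U j)⁻¹ ∈ V} ≤
          sunLeapfrogHMCN (sunCoordι N) (sunCoordι_skew N) ε (Measure.addHaar : Measure (SUNCoords N))
            (sunKinetic N) (hg ε) S nstep U := by
  -- the uniform walk minorant of §2, in the engine's coordinates
  obtain ⟨δ, hδ, hwalk⟩ := sunLeapfrogHMCN_minorised_walk_uniform (sunCoordι N) (sunCoordι_skew N)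
    (sunCoordι_injective N) Measure.addHaar (τ := fun R => Fintype.card L * ((N + 4 * Fintype.card (UpperPair N)) * R ^ 2))
    (sunCoordι_range N) hε₁ h12 hn (measurable_sunKinetic N) (sunKinetic_nonneg N) (sunKinetic_le_of_norm_le N)
    (sunMomentumWeight_sunKinetic_ne_top N Measure.addHaar) hg hb0 hb hK0 hK hS hs h1 h2 h3
  -- the chart kick of radius `nε₁/3` dominates Haar near `1`
  have hr₁ : 0 < (nstep : ℝ) * ε₁ / 3 := by have : (0 : ℝ) < nstep := Nat.cast_pos.2 hn; positivity
  obtain ⟨V, hV, a, ha, hle⟩ := exists_smul_haar_restrict_le_chartKickR (sunCoordι N) (sunCoordι_skew N)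
    Measure.addHaar (sunCoordι_injective N) (sunCoordι_range N) hr₁
  have hcoord : ∀ _j : L, a • (haarProbability (Matrix.specialUnitaryGroup (Fin N) ℂ)).restrict (interior V) ≤
      chartKickR (sunCoordι N) (sunCoordι_skew N) (Measure.addHaar : Measure (SUNCoords N)) (nstep * ε₁ / 3) := fun _ =>
    calc a • (haarProbability (Matrix.specialUnitaryGroup (Fin N) ℂ)).restrict (interior V)
        ≤ a • (haarProbability (Matrix.specialUnitaryGroup (Fin N) ℂ)).restrict V :=
          measure_smul_le_smul_of_le (Measure.restrict_mono interior_subset le_rfl) a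
      _ ≤ _ := hle
  haveI : IsProbabilityMeasure (chartKickR (sunCoordι N) (sunCoordι_skew N) (Measure.addHaar : Measure (SUNCoords N))
      (nstep * ε₁ / 3)) :=
    isProbabilityMeasure_chartKickR (sunCoordι N) (sunCoordι_skew N) Measure.addHaar hr₁
  refine ⟨interior V, isOpen_interior, mem_interior_iff_mem_nhds.2 hV, δ * ∏ _j : L, a,
    mul_ne_zero hδ.ne' (Finset.prod_ne_zero_iff.2 fun _ _ => ha), fun ε hε U => ?_⟩
  calc (δ * ∏ _j : L, a) • (Measure.pi fun _ : L => haarProbability (Matrix.specialUnitaryGroup (Fin N) ℂ)).restrict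
          {W | ∀ j, W j * (U j)⁻¹ ∈ interior V}
      = δ • ((∏ _j : L, a) • (Measure.pi fun _ : L => haarProbability (Matrix.specialUnitaryGroup (Fin N) ℂ)).restrict
          {W | ∀ j, W j * (U j)⁻¹ ∈ interior V}) := by rw [smul_smul]
    _ ≤ δ • mulWalk (Measure.pi fun _ : L => chartKickR (sunCoordι N) (sunCoordι_skew N)
          (Measure.addHaar : Measure (SUNCoords N)) (nstep * ε₁ / 3)) U :=
        measure_smul_le_smul_of_le
          (smul_restrict_box_le_mulWalk_pi (μH := haarProbability (Matrix.specialUnitaryGroup (Fin N) ℂ)) hcoord U) δ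
    _ ≤ _ := hwalk ε hε U

variable {F : (L → Matrix.specialUnitaryGroup (Fin N) ℂ) → L → SUNCoords N} {Fmax KF : ℝ}

/-- **TRAJECTORY-LENGTH FORM WITH THE ENGINE'S HALF KICK `−(ε/2)·F`** (measurable `F` bounded by `F_max` per link
and `K_F`-Lipschitz, measurable action bounded by `s`): there is `τ₀ > 0` (the threshold of
`engine_sunLeapfrogHMCN_box_minorised_of_trajLength`) such that for EVERY `nstep ≥ 1` and EVERY
`0 < τ₁ ≤ τ₂ ≤ τ₀` ONE open `V ∋ 1` and ONE `κ ≠ 0` give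
`κ · Haar^{⊗links}|_{box_V(U)} ≤ K_{nstep, τ'/nstep}(U, ·)` for EVERY trajectory length `τ' ∈ [τ₁, τ₂]` and EVERY
`U` — the common minorant over an interval of lengths. -/
theorem engine_sunLeapfrogHMCN_box_minorised_uniform_of_trajLength (hF : Measurable F) (hF0 : 0 ≤ Fmax)
    (hFb : ∀ U l, ‖F U l‖ ≤ Fmax) (hKF0 : 0 ≤ KF) (hFK : ∀ U U', ‖F U - F U'‖ ≤ KF * ‖coeConfig U - coeConfig U'‖)
    (hS : Measurable S) (hs : ∀ u, |S u| ≤ s) :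
    ∃ τ₀ : ℝ, 0 < τ₀ ∧ ∀ (nstep : ℕ) (τ₁ τ₂ : ℝ), 1 ≤ nstep → 0 < τ₁ → τ₁ ≤ τ₂ → τ₂ ≤ τ₀ →
      ∃ V : Set (Matrix.specialUnitaryGroup (Fin N) ℂ), IsOpen V ∧ (1 : Matrix.specialUnitaryGroup (Fin N) ℂ) ∈ V ∧
        ∃ κ : ℝ≥0∞, κ ≠ 0 ∧ ∀ τ' ∈ Icc τ₁ τ₂, ∀ U : L → Matrix.specialUnitaryGroup (Fin N) ℂ,
          κ • (Measure.pi fun _ : L => haarProbability (Matrix.specialUnitaryGroup (Fin N) ℂ)).restrict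
              {W | ∀ j, W j * (U j)⁻¹ ∈ V} ≤
            sunLeapfrogHMCN (sunCoordι N) (sunCoordι_skew N) (τ' / nstep) (Measure.addHaar : Measure (SUNCoords N))
              (sunKinetic N) (measurable_halfKick_sun N hF (τ' / nstep)) S nstep U := by
  set s₀ := sunShortTrajThreshold (sunCoordι N) (sunCoordι_injective N) with hs₀
  have hs₀0 : 0 < s₀ := sunShortTrajThreshold_pos _ _
  refine ⟨min s₀ (min (s₀ / (3 * Fmax + 1)) (Real.sqrt (s₀ / (KF + 1)))),
    lt_min hs₀0 (lt_min (by positivity) (Real.sqrt_pos.2 (by positivity))), fun nstep τ₁ τ₂ hn hτ₁ h12 hτ => ?_⟩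
  have hn0 : (0 : ℝ) < nstep := Nat.cast_pos.2 hn
  have hε₂ : 0 < τ₂ / nstep := div_pos (hτ₁.trans_le h12) hn0
  obtain ⟨h1, h2, h3⟩ := trajLength_threshold_arith hs₀0 hF0 hKF0 hn hε₂ rfl
    (show (nstep : ℝ) * (τ₂ / nstep) ≤ _ by rwa [mul_div_cancel₀ _ hn0.ne'])
  -- the family `ε ↦ −(ε/2)·F` on `[τ₁/nstep, τ₂/nstep]`: uniform bounds `(τ₂/2nstep)·F_max`, `(τ₂/2nstep)·K_F`
  have hbnd : ∀ ε ∈ Icc (τ₁ / nstep) (τ₂ / nstep), ∀ (U : L → Matrix.specialUnitaryGroup (Fin N) ℂ) (l : L),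
      ‖((-(ε / 2)) • F U) l‖ ≤ τ₂ / nstep / 2 * Fmax := fun ε hε U l => by
    have hε0 : 0 < ε := (div_pos hτ₁ hn0).trans_le hε.1
    rw [Pi.smul_apply, norm_smul, Real.norm_eq_abs, abs_neg, abs_of_pos (by positivity)]
    exact mul_le_mul (by linarith [hε.2]) (hFb U l) (norm_nonneg _) (by positivity)
  have hlip : ∀ ε ∈ Icc (τ₁ / nstep) (τ₂ / nstep), ∀ U U' : L → Matrix.specialUnitaryGroup (Fin N) ℂ,
      ‖(-(ε / 2)) • F U - (-(ε / 2)) • F U'‖ ≤ τ₂ / nstep / 2 * KF * ‖coeConfig U - coeConfig U'‖ := fun ε hε U U' => by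
    have hε0 : 0 < ε := (div_pos hτ₁ hn0).trans_le hε.1
    have hsub : (-(ε / 2)) • F U - (-(ε / 2)) • F U' = (-(ε / 2)) • (F U - F U') := by
      funext l; simp only [Pi.sub_apply, Pi.smul_apply, smul_sub]
    rw [hsub, norm_smul, Real.norm_eq_abs, abs_neg, abs_of_pos (by positivity)]
    calc ε / 2 * ‖F U - F U'‖ ≤ ε / 2 * (KF * ‖coeConfig U - coeConfig U'‖) :=
          mul_le_mul_of_nonneg_left (hFK U U') (by positivity)
      _ ≤ τ₂ / nstep / 2 * (KF * ‖coeConfig U - coeConfig U'‖) :=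
          mul_le_mul_of_nonneg_right (by linarith [hε.2]) (by positivity)
      _ = τ₂ / nstep / 2 * KF * ‖coeConfig U - coeConfig U'‖ := by ring
  obtain ⟨V, hVo, hV1, κ, hκ, hbox⟩ := engine_sunLeapfrogHMCN_box_minorised_uniform N (ε₁ := τ₁ / nstep) (ε₂ := τ₂ / nstep)
    (g := fun ε U => (-(ε / 2)) • F U) (div_pos hτ₁ hn0) (div_le_div_of_nonneg_right h12 hn0.le) hn
    (fun ε => measurable_halfKick_sun N hF ε) (b := τ₂ / nstep / 2 * Fmax) (Kg := τ₂ / nstep / 2 * KF) (by positivity)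
    hbnd (by positivity) hlip hS hs h1 h2 h3
  exact ⟨V, hVo, hV1, κ, hκ, fun τ' hτ' U => hbox (τ' / nstep) ⟨div_le_div_of_nonneg_right hτ'.1 hn0.le,
    div_le_div_of_nonneg_right hτ'.2 hn0.le⟩ U⟩

end Box

end Summit.Ventures.LatticeQCDFlow.Exactness
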